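import Literature.Probability.RandomPlanarGeometry.RadialBesselComparison
import HarnessLib

/-!
# The radial Bessel flow: exponential contraction in the starting point (synchronous coupling)

Topic `Probability/RandomPlanarGeometry`; theorems only, sequel of `RadialBesselComparison`. For
ONE continuous driving path `U` and two starting points `θ₁ ≤ θ₂`, the radial Bessel flows
`Yₜ = θ + ∫₀ᵗ cot(Y_s/2) ds - (Uₜ - U₀)` (Lawler (2005), (1.16), (6.12); LSW (2002), (2.9)–(2.11))
are ordered and their gap is non-increasing (`RadialBesselComparison`, Lawler (2005), §1.11.2).
Here we record the quantitative form of the same computation: since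
`d/dy cot(y/2) = -1/(2 sin²(y/2)) ≤ -1/2` on `(0, 2π)`, the gap `G = Y^{θ₂} - Y^{θ₁}` satisfies
`G' = cot(Y^{θ₂}/2) - cot(Y^{θ₁}/2) ≤ -G/2`, hence

  `0 ≤ Y^{θ₂}ₜ - Y^{θ₁}ₜ ≤ (θ₂ - θ₁) e^{-t/2}`

as long as both flows are alive (`sub_argTrunc_le_mul_exp` for the truncated flows of one level
inside their interval, `arg_sub_arg_le_mul_exp`, `abs_arg_sub_arg_le_mul_exp` for the maximal
flows below both level-`n` exit times, `abs_arg_sub_arg_le_mul_exp_of_lifetime_eq_top` for all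
times when both lifetimes are infinite). This **synchronous coupling** of the solutions of
`dθ = ((ρ+2)/2) cot(θ/2) dt + √κ dB` from two initial values is the (elementary) contraction that
drives the convergence to, and the uniqueness of, the stationary solution of the SLE_κ(ρ) angle
equation (Miller–Sheffield (2013/2017), §2.1.2 eq. (2.5) and Prop. 2.1, where a Doeblin-type
coupling is sketched instead); it is used for that purpose in the tree's proof of
`IsStationaryAngleLaw.exists_unique` (`WholePlaneSLE`).

Also proved here, for want of a Mathlib API for `Real.cot`: `Real.hasDerivAt_cot`
(`cot' = -1/sin²` where `sin ≠ 0`) and the one-sided Lipschitz bound `sub_le_cot_sub_cot`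
(`b - a ≤ cot a - cot b` for `δ ≤ a ≤ b ≤ π - δ`).

## References

* G. F. Lawler, *Conformally Invariant Processes in the Plane*, AMS (2005), §1.11.2 (pp. 39–40:
  `d/dt [X_t^y - X_t^x] = (a/2)[cot(X_t^y/2) - cot(X_t^x/2)]`). [Lawler2005]
* J. Miller, S. Sheffield, *Imaginary geometry IV*, Probab. Theory Related Fields 169 (2017),
  arXiv:1302.4738, §2.1.2, eq. (2.5), Prop. 2.1. [MillerSheffield2013]
-/

noncomputable section

open Set Filter Topology MeasureTheory Metric

/-! ### The cotangent: derivative and one-sided Lipschitz bound -/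

/-- **`cot' = -1/sin²`** at every point where `sin ≠ 0`. [folklore] -/
theorem Real.hasDerivAt_cot {x : ℝ} (hx : Real.sin x ≠ 0) :
    HasDerivAt Real.cot (-(Real.sin x ^ 2)⁻¹) x := by
  have hfun : Real.cot = fun y ↦ Real.cos y / Real.sin y := funext Real.cot_eq_cos_div_sin
  rw [hfun]
  have h := (Real.hasDerivAt_cos x).div (Real.hasDerivAt_sin x) hx
  have heq : (-Real.sin x * Real.sin x - Real.cos x * Real.cos x) / Real.sin x ^ 2 =
      -(Real.sin x ^ 2)⁻¹ := by
    have hsc : Real.sin x ^ 2 + Real.cos x ^ 2 = 1 := Real.sin_sq_add_cos_sq x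
    have h1 : -Real.sin x * Real.sin x - Real.cos x * Real.cos x = -1 := by nlinarith
    rw [h1, div_eq_mul_inv, neg_one_mul]
  rw [heq] at h
  exact h

namespace Literature.Probability.RandomPlanarGeometry

namespace RadialLoewner

open scoped NNReal

variable {Ω : Type*} {mΩ : MeasurableSpace Ω} {U : Ω → ℝ≥0 → ℝ}

section Cot

variable {δ : ℝ}

/-- **`cot` decreases at rate at least one**: `b - a ≤ cot a - cot b` for `δ ≤ a ≤ b ≤ π - δ`
(`0 < δ`), by the mean value theorem and `-cot' = 1/sin² ≥ 1`. [folklore] -/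
theorem sub_le_cot_sub_cot (hδ : 0 < δ) {a b : ℝ} (ha : a ∈ Icc δ (Real.pi - δ))
    (hb : b ∈ Icc δ (Real.pi - δ)) (hab : a ≤ b) : b - a ≤ Real.cot a - Real.cot b := by
  have hsin : ∀ z ∈ Icc a b, Real.sin z ≠ 0 := fun z hz ↦
    (sin_pos_of_mem hδ ⟨ha.1.trans hz.1, hz.2.trans hb.2⟩).ne'
  have hcont : ContinuousOn Real.cot (Icc a b) := fun z hz ↦
    (Real.hasDerivAt_cot (hsin z hz)).continuousAt.continuousWithinAt
  have hdiff : DifferentiableOn ℝ Real.cot (interior (Icc a b)) := fun z hz ↦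
    (Real.hasDerivAt_cot (hsin z (interior_subset hz))).differentiableAt.differentiableWithinAt
  have hderiv : ∀ z ∈ interior (Icc a b), deriv Real.cot z ≤ -1 := by
    intro z hz
    have hz' := interior_subset hz
    have hs0 : 0 < Real.sin z := sin_pos_of_mem hδ ⟨ha.1.trans hz'.1, hz'.2.trans hb.2⟩
    rw [(Real.hasDerivAt_cot (hsin z hz')).deriv]
    have hs1 : Real.sin z ^ 2 ≤ 1 := by
      rw [sq_le_one_iff_abs_le_one]; exact Real.abs_sin_le_one z
    have hpos : 0 < Real.sin z ^ 2 := by positivity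
    have : 1 ≤ (Real.sin z ^ 2)⁻¹ := by rwa [le_inv_comm₀ one_pos hpos, inv_one]
    linarith
  have h := (convex_Icc a b).image_sub_le_mul_sub_of_deriv_le hcont hdiff hderiv a
    (left_mem_Icc.2 hab) b (right_mem_Icc.2 hab) hab
  linarith

/-- **The clamped cotangent decreases at rate at least one on the untruncated region**:
`cotTrunc δ y - cotTrunc δ x ≤ -(y - x)` for `δ ≤ x ≤ y ≤ π - δ`. [folklore] -/
theorem cotTrunc_sub_cotTrunc_le (hδ : 0 < δ) {x y : ℝ} (hx : x ∈ Icc δ (Real.pi - δ))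
    (hy : y ∈ Icc δ (Real.pi - δ)) (hxy : x ≤ y) : cotTrunc δ y - cotTrunc δ x ≤ -(y - x) := by
  rw [cotTrunc_eq_cot hx, cotTrunc_eq_cot hy]
  linarith [sub_le_cot_sub_cot hδ hx hy hxy]

end Cot

/-! ### Exponential contraction of the truncated flows inside their interval -/

section Truncated

variable (hc : ∀ ω, Continuous (U ω)) {δ : ℝ} (hδ : 0 < δ) (hδ' : δ ≤ Real.pi / 2)
include hc hδ hδ'

/-- **Exponential contraction (one level).** For one driving path, `θ₁ ≤ θ₂` both inside the
level-`δ` interval `(2δ, 2π - 2δ)`, and a time `t` before both exit times `σ_δ(θ₁)`, `σ_δ(θ₂)`,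
the gap of the truncated flows satisfies `Y^{θ₂}ₜ - Y^{θ₁}ₜ ≤ (θ₂ - θ₁) e^{-t/2}`: on `[0, t]`
both flows are in `[2δ, 2π - 2δ]`, where the truncation is inactive and
`d/dt (Y^{θ₂} - Y^{θ₁}) = cot(Y^{θ₂}/2) - cot(Y^{θ₁}/2) ≤ -(Y^{θ₂} - Y^{θ₁})/2`, so that
`e^{t/2}(Y^{θ₂}ₜ - Y^{θ₁}ₜ)` is non-increasing (Lawler (2005), §1.11.2, made quantitative).
[cite: Lawler2005, §1.11.2] -/
theorem sub_argTrunc_le_mul_exp {θ₁ θ₂ : ℝ} (hθ : θ₁ ≤ θ₂)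
    (hθ₁ : θ₁ ∈ Ioo (2 * δ) (2 * Real.pi - 2 * δ)) (hθ₂ : θ₂ ∈ Ioo (2 * δ) (2 * Real.pi - 2 * δ))
    (ω : Ω) {t : ℝ≥0} (h₁ : (t : WithTop ℝ≥0) ≤ truncExit U hc hδ hδ' θ₁ ω)
    (h₂ : (t : WithTop ℝ≥0) ≤ truncExit U hc hδ hδ' θ₂ ω) :
    argTrunc U δ hc hδ hδ' θ₂ t ω - argTrunc U δ hc hδ hδ' θ₁ t ω ≤
      (θ₂ - θ₁) * Real.exp (-(t : ℝ) / 2) := by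
  -- work on the horizon `[0, t]` with the truncated solutions
  set Z₁ := truncSol (t := t) hc hδ hδ' θ₁ ω with hZ₁
  set Z₂ := truncSol (t := t) hc hδ hδ' θ₂ ω with hZ₂
  -- the weighted gap `H(r) = e^{r/2} (Z₂ r - Z₁ r)`
  set H : ℝ → ℝ := fun r ↦ Real.exp (r / 2) * (Z₂ r - Z₁ r) with hH
  have hder : ∀ r ∈ Icc (0 : ℝ) t, HasDerivWithinAt H
      (Real.exp (r / 2) * (1 / 2) * (Z₂ r - Z₁ r) + Real.exp (r / 2) *
        (radialField (U ω) δ r (Z₂ r) - radialField (U ω) δ r (Z₁ r))) (Icc (0 : ℝ) t) r := by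
    intro r hr
    have hexp : HasDerivWithinAt (fun r ↦ Real.exp (r / 2)) (Real.exp (r / 2) * (1 / 2))
        (Icc (0 : ℝ) t) r :=
      ((hasDerivAt_id' r).div_const 2).exp.hasDerivWithinAt
    exact hexp.mul ((hasDerivWithinAt_truncSol hc hδ hδ' θ₂ ω hr).sub
      (hasDerivWithinAt_truncSol hc hδ hδ' θ₁ ω hr))
  -- on `[0, t]` both flows are in `[2δ, 2π - 2δ]`, ordered
  have hmem : ∀ {θ : ℝ}, θ ∈ Ioo (2 * δ) (2 * Real.pi - 2 * δ) →
      (t : WithTop ℝ≥0) ≤ truncExit U hc hδ hδ' θ ω → ∀ r ∈ Icc (0 : ℝ) t,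
      (truncSol (t := t) hc hδ hδ' θ ω r - (U ω r.toNNReal - U ω 0)) / 2 ∈ Icc δ (Real.pi - δ) := by
    intro θ hθi hti r hr
    have hrt : (r.toNNReal : ℝ≥0) ≤ t := (Real.toNNReal_le_iff_le_coe).2 hr.2
    have hle : ((r.toNNReal : ℝ≥0) : WithTop ℝ≥0) ≤ truncExit U hc hδ hδ' θ ω :=
      (WithTop.coe_le_coe.2 hrt).trans hti
    have hY := argTrunc_mem_Icc_of_le_truncExit hc hδ hδ' hθi ω hle
    rw [argTrunc_toNNReal_eq_of_mem hc hδ hδ' θ ω hr] at hY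
    constructor <;> linarith [hY.1, hY.2]
  have hanti : AntitoneOn H (Icc (0 : ℝ) t) := by
    refine antitoneOn_of_hasDerivWithinAt_nonpos (convex_Icc _ _)
      (fun r hr ↦ (hder r hr).continuousWithinAt)
      (fun r hr ↦ (hder r (interior_subset hr)).mono interior_subset) fun r hr ↦ ?_
    have hr' := interior_subset hr
    have hx := hmem hθ₁ h₁ r hr'
    have hy := hmem hθ₂ h₂ r hr'
    have hle : Z₁ r ≤ Z₂ r := truncSol_mono hc hδ hδ' hθ ω (t := t) hr'
    have hxy : (Z₁ r - (U ω r.toNNReal - U ω 0)) / 2 ≤ (Z₂ r - (U ω r.toNNReal - U ω 0)) / 2 := by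
      linarith
    have hfield : radialField (U ω) δ r (Z₂ r) - radialField (U ω) δ r (Z₁ r) ≤
        -((Z₂ r - Z₁ r) / 2) := by
      rw [radialField_apply, radialField_apply]
      have h := cotTrunc_sub_cotTrunc_le hδ hx hy hxy
      linarith
    have hpos : 0 < Real.exp (r / 2) := Real.exp_pos _
    nlinarith
  have hH0 : H 0 = θ₂ - θ₁ := by
    simp only [hH, hZ₁, hZ₂, zero_div, Real.exp_zero, one_mul, truncSol_zero]
  have hHt : H t = Real.exp ((t : ℝ) / 2) *
      (argTrunc U δ hc hδ hδ' θ₂ t ω - argTrunc U δ hc hδ hδ' θ₁ t ω) := by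
    simp only [hH]
    rw [argTrunc_eq_of_le hc hδ hδ' θ₁ ω le_rfl, argTrunc_eq_of_le hc hδ hδ' θ₂ ω le_rfl]
    ring
  have hmono := hanti ⟨le_rfl, t.coe_nonneg⟩ ⟨t.coe_nonneg, le_rfl⟩ t.coe_nonneg
  rw [hH0, hHt] at hmono
  have hpos : 0 < Real.exp ((t : ℝ) / 2) := Real.exp_pos _
  rw [show -(t : ℝ) / 2 = -((t : ℝ) / 2) by ring, Real.exp_neg]
  rw [le_mul_inv_iff₀ hpos]
  linarith

end Truncated

/-! ### Exponential contraction of the maximal flows -/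

section Maximal

variable (hc : ∀ ω, Continuous (U ω))
include hc

/-- **Exponential contraction of the radial Bessel flows** below both level-`n` exit times:
for `θ₁ ≤ θ₂` and `t ≤ σₙ(θ₁) ∧ σₙ(θ₂)`, `Y^{θ₂}ₜ - Y^{θ₁}ₜ ≤ (θ₂ - θ₁) e^{-t/2}`.
[cite: Lawler2005, §1.11.2] -/
theorem arg_sub_arg_le_mul_exp {θ₁ θ₂ : ℝ} (hθ : θ₁ ≤ θ₂) {ω : Ω} {t : ℝ≥0} {n : ℕ}
    (h₁ : (t : WithTop ℝ≥0) ≤ exitLevel U hc n θ₁ ω) (h₂ : (t : WithTop ℝ≥0) ≤ exitLevel U hc n θ₂ ω) :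
    arg U hc θ₂ t ω - arg U hc θ₁ t ω ≤ (θ₂ - θ₁) * Real.exp (-(t : ℝ) / 2) := by
  -- if a start is outside the level-`n` interval, its exit time is `0`, so `t = 0`
  have htriv : t = 0 → arg U hc θ₂ t ω - arg U hc θ₁ t ω ≤ (θ₂ - θ₁) * Real.exp (-(t : ℝ) / 2) := by
    rintro rfl
    simp [arg_zero]
  by_cases hθ₁ : θ₁ ∈ Ioo (2 * level n) (2 * Real.pi - 2 * level n)
  · by_cases hθ₂ : θ₂ ∈ Ioo (2 * level n) (2 * Real.pi - 2 * level n)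
    · rw [arg_eq_argLevel hc h₁, arg_eq_argLevel hc h₂]
      exact sub_argTrunc_le_mul_exp hc (level_pos n) (level_le n) hθ hθ₁ hθ₂ ω h₁ h₂
    · refine htriv ?_
      have h0 := exitLevel_eq_zero_of_not_mem hc hθ₂ ω
      rw [h0, nonpos_iff_eq_zero, WithTop.coe_eq_zero] at h₂
      exact h₂
  · refine htriv ?_
    have h0 := exitLevel_eq_zero_of_not_mem hc hθ₁ ω
    rw [h0, nonpos_iff_eq_zero, WithTop.coe_eq_zero] at h₁
    exact h₁

/-- **Exponential contraction, symmetric form**: below both level-`n` exit times,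
`|Y^{θ₂}ₜ - Y^{θ₁}ₜ| ≤ |θ₂ - θ₁| e^{-t/2}` (no order assumption on the starts).
[cite: Lawler2005, §1.11.2] -/
theorem abs_arg_sub_arg_le_mul_exp {θ₁ θ₂ : ℝ} {ω : Ω} {t : ℝ≥0} {n : ℕ}
    (h₁ : (t : WithTop ℝ≥0) ≤ exitLevel U hc n θ₁ ω) (h₂ : (t : WithTop ℝ≥0) ≤ exitLevel U hc n θ₂ ω) :
    |arg U hc θ₂ t ω - arg U hc θ₁ t ω| ≤ |θ₂ - θ₁| * Real.exp (-(t : ℝ) / 2) := by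
  rcases le_total θ₁ θ₂ with hθ | hθ
  · have hnn : 0 ≤ arg U hc θ₂ t ω - arg U hc θ₁ t ω :=
      sub_nonneg.2 (arg_mono hc hθ h₁ h₂)
    rw [abs_of_nonneg hnn, abs_of_nonneg (sub_nonneg.2 hθ)]
    exact arg_sub_arg_le_mul_exp hc hθ h₁ h₂
  · have hnp : arg U hc θ₂ t ω - arg U hc θ₁ t ω ≤ 0 :=
      sub_nonpos.2 (arg_mono hc hθ h₂ h₁)
    rw [abs_of_nonpos hnp, abs_of_nonpos (sub_nonpos.2 hθ), neg_sub, neg_sub]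
    exact arg_sub_arg_le_mul_exp hc hθ h₂ h₁

/-- **Exponential contraction for all times when both flows live forever**: if the lifetimes of
the flows from `θ₁` and `θ₂` are both infinite, then `|Y^{θ₂}ₜ - Y^{θ₁}ₜ| ≤ |θ₂ - θ₁| e^{-t/2}`
for every `t`. This is the synchronous-coupling contraction behind the uniqueness of the
stationary solution of the SLE_κ(ρ) angle equation (Miller–Sheffield (2017), Prop. 2.1) in the
non-hitting regime. [cite: MillerSheffield2013, Prop. 2.1] -/
theorem abs_arg_sub_arg_le_mul_exp_of_lifetime_eq_top {θ₁ θ₂ : ℝ} {ω : Ω}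
    (hT₁ : lifetime U hc θ₁ ω = ⊤) (hT₂ : lifetime U hc θ₂ ω = ⊤) (t : ℝ≥0) :
    |arg U hc θ₂ t ω - arg U hc θ₁ t ω| ≤ |θ₂ - θ₁| * Real.exp (-(t : ℝ) / 2) := by
  have ht₁ : (t : WithTop ℝ≥0) < lifetime U hc θ₁ ω := by rw [hT₁]; exact WithTop.coe_lt_top t
  have ht₂ : (t : WithTop ℝ≥0) < lifetime U hc θ₂ ω := by rw [hT₂]; exact WithTop.coe_lt_top t
  obtain ⟨N₁, hN₁⟩ := eventually_lt_exitLevel hc ht₁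
  obtain ⟨N₂, hN₂⟩ := eventually_lt_exitLevel hc ht₂
  exact abs_arg_sub_arg_le_mul_exp hc (hN₁ (max N₁ N₂) (le_max_left _ _)).le
    (hN₂ (max N₁ N₂) (le_max_right _ _)).le

end Maximal

end RadialLoewner

end Literature.Probability.RandomPlanarGeometry
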